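import Literature.AnabelianGeometry.SemiGraphs.PSCSeparatingCoveringsThreeChainPointed
import Literature.AnabelianGeometry.SemiGraphs.PSCSeparatingCoveringsTwoComponentUnmarkedEdgesOneCusp
import HarnessLib

/-!
# [CombGC] Prop. 1.2, proof p. 9: VERTICIAL separating coverings at THREE-COMPONENT CHAINS with an UNMARKED MIDDLE component (row F-2826)

Mochizuki, *A combinatorial version of the Grothendieck conjecture*, Tohoku Math. J. **59** (2007)
[CombGC], PROOF of Proposition 1.2, p. 9 [cite: MochizukiCombGC2007, Prop 1.2 proof p.9]; typed LEVEL-WISE as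
`PSCDatum.VerticialSeparatingCoverings` (abc-iut-w4-d081, row P12-L01-V; abc-iut FACT-LIST row F-2826 — a schema
whose universal closure is refuted as typed; the instance forms at genuine carriers are the content).

PROOF-ONLY file (abc-iut-f-166 gen 6, row «UNMARKED-MIDDLE-CHAIN», file 2; 0 definitions).  The carrier:
abc-iut-f-164's three-component chain `C₀ ∪_{ν_A} C_mid ∪_{ν_B} C₁` with the MIDDLE component UNMARKED
(`s₁ = s₂ = s`, `1 ≤ s < r`, `1 ≤ g₀ < g₁ < g`), over a profinite pro-`Σ` completion `ι : Γ_{g,r} → Π`.  TWO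
node-loop bases are used: `b_A` of `(g₀, s)` (carries `ε_A`) and `b_B` of `(g₁, s)` (carries `η`), with the same
handle letters.  In `b_A`: `Π_{v₀} = cl ι⟨b_A(S₀)⟩` (abc-iut-f-164's `closure_firstSubsurface_eq_nodeLoopBasis`) and
— the point of this file — the MIDDLE vertex group `Π_{v_mid} = cl ι⟨a_i, b_i (g₀ ≤ i < g₁), ε_A, η⟩ =
cl ι⟨b_A(S_mid)⟩`, `S_mid = {middle handles} ∪ {slot of ε_A}`, is a FREE-FACTOR closure because
`η = ε_A · ∏_{g₀≤i<g₁}[a_i,b_i]` is redundant (`closure_chainMid_unmarkedMid_eq`); in `b_B`: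
`Π_{v₁} = cl ι⟨b_B(T₁)⟩` (`closure_secondSubsurface_eq_nodeLoopBasis`).  Hence every pair of level vertices is
separated by gen 3's free-factor fibred twist / projection (`freeFactor_exists_open_separating_sameVertex`,
`…_crossVertex`) with handle-letter witnesses `a_0`, `a_{g₀}`, `a_{g₁}` — no character and no cut-off needed.

* `closure_chainMid_unmarkedMid_eq` — the middle vertex group in the basis `b_A`;
* `verticialSeparatingCoverings_of_threeChain_unmarkedMid` — **F-2826** (`V' := V`) at EVERY such datum.

Instance forms at data of the shape of genuine stable curves: consistency evidence for the typed schema, not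
the printed theorem for all pointed stable curves.  Nothing here takes a side on [IUTchIII] Cor. 3.12.
-/

noncomputable section

/-! ### The middle vertex group when the middle component is unmarked -/

namespace Literature.GroupTheory.CombinatorialGroupTheory.PuncturedSurfaceGroup

variable {g r' g₀ g₁ s₁ : ℕ} {εA η : PuncturedSurfaceGroup g (r' + 1)}
  {B : FreeGroupBasis ((Fin g × Bool) ⊕ Fin r') (PuncturedSurfaceGroup g (r' + 1))}

/-- **The middle component of a chain whose middle component is unmarked**, in the node-loop basis `B` of
`(g₀, s₁)` (slot `s₁ − 1 ↦ ε_A`): for `g₀ ≤ g₁`, `1 ≤ s₁ ≤ r'`,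
`⟨a_i, b_i (g₀ ≤ i < g₁), ε_A, η⟩ = ⟨B(S_mid)⟩`, `S_mid = {(i,·) : g₀ ≤ i < g₁} ∪ {s₁ − 1}` — `η = ε_A ∏_{g₀≤i<g₁}[a_i,b_i]`
is redundant (`comm_prod_lt_split`). [cite: MochizukiSemiAnbd2006, Ex. 2.10 p.31] -/
theorem closure_chainMid_unmarkedMid_eq
    (hεA : εA = ((List.finRange (r' + 1)).map fun j : Fin (r' + 1) =>
        if s₁ ≤ (j : ℕ) then c (g := g) j else 1).prod *
      ((List.finRange g).map fun i : Fin g => if (i : ℕ) < g₀ then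
        a (r := r' + 1) i * b i * (a i)⁻¹ * (b i)⁻¹ else 1).prod)
    (hη : η = ((List.finRange (r' + 1)).map fun j : Fin (r' + 1) =>
        if s₁ ≤ (j : ℕ) then c (g := g) j else 1).prod *
      ((List.finRange g).map fun i : Fin g => if (i : ℕ) < g₁ then
        a (r := r' + 1) i * b i * (a i)⁻¹ * (b i)⁻¹ else 1).prod)
    (ha : ∀ i, B (Sum.inl (i, false)) = a i) (hb : ∀ i, B (Sum.inl (i, true)) = b i)
    (hA : ∀ h : s₁ - 1 < r', B (Sum.inr ⟨s₁ - 1, h⟩) = εA) (hg : g₀ ≤ g₁) (hs₁ : 1 ≤ s₁) (hsr : s₁ ≤ r') :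
    Subgroup.closure {x : PuncturedSurfaceGroup g (r' + 1) |
        (∃ i : Fin g, (g₀ ≤ (i : ℕ) ∧ (i : ℕ) < g₁) ∧ (x = a i ∨ x = b i)) ∨
          (∃ j : Fin (r' + 1), (s₁ ≤ (j : ℕ) ∧ (j : ℕ) < s₁) ∧ x = c j) ∨ x = εA ∨ x = η} =
      Subgroup.closure (B '' {x | Sum.elim (fun p : Fin g × Bool => g₀ ≤ (p.1 : ℕ) ∧ (p.1 : ℕ) < g₁)
        (fun j : Fin r' => (j : ℕ) + 1 = s₁) x}) := by
  classical
  set Sm : Set ((Fin g × Bool) ⊕ Fin r') := {x | Sum.elim (fun p : Fin g × Bool => g₀ ≤ (p.1 : ℕ) ∧ (p.1 : ℕ) < g₁)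
    (fun j : Fin r' => (j : ℕ) + 1 = s₁) x} with hSm
  have hml : ∀ p : Fin g × Bool, (Sum.inl p : (Fin g × Bool) ⊕ Fin r') ∈ Sm ↔
      g₀ ≤ (p.1 : ℕ) ∧ (p.1 : ℕ) < g₁ := fun _ => Iff.rfl
  have hmr : ∀ j : Fin r', (Sum.inr j : (Fin g × Bool) ⊕ Fin r') ∈ Sm ↔ (j : ℕ) + 1 = s₁ := fun _ => Iff.rfl
  set R := Subgroup.closure (B '' Sm) with hR
  have hmemR : ∀ x, x ∈ Sm → B x ∈ R := fun x hx => Subgroup.subset_closure ⟨x, hx, rfl⟩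
  have haR : ∀ i : Fin g, g₀ ≤ (i : ℕ) → (i : ℕ) < g₁ → a (r := r' + 1) i ∈ R := fun i h1 h2 => by
    rw [← ha i]; exact hmemR _ ((hml _).mpr ⟨h1, h2⟩)
  have hbR : ∀ i : Fin g, g₀ ≤ (i : ℕ) → (i : ℕ) < g₁ → b (r := r' + 1) i ∈ R := fun i h1 h2 => by
    rw [← hb i]; exact hmemR _ ((hml _).mpr ⟨h1, h2⟩)
  have hεR : εA ∈ R := by rw [← hA (by omega)]; exact hmemR _ ((hmr _).mpr (by simp only; omega))
  -- `η = ε_A · ∏_{g₀≤i<g₁}[a_i,b_i]`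
  have hηε : η = εA * ((List.finRange g).map fun i : Fin g => if g₀ ≤ (i : ℕ) ∧ (i : ℕ) < g₁ then
      a (r := r' + 1) i * b i * (a i)⁻¹ * (b i)⁻¹ else 1).prod := by
    rw [hη, comm_prod_lt_split (r := r' + 1) g₀ g₁ hg, ← mul_assoc, ← hεA]
  have hηR : η ∈ R := by
    rw [hηε]
    exact R.mul_mem hεR (comm_prod_ite_mem _ _ (fun i hi => haR i hi.1 hi.2) (fun i hi => hbR i hi.1 hi.2))
  apply le_antisymm
  · rw [Subgroup.closure_le]
    rintro x (⟨i, ⟨h1, h2⟩, rfl | rfl⟩ | ⟨j, ⟨hj1, hj2⟩, -⟩ | rfl | rfl)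
    · exact haR i h1 h2
    · exact hbR i h1 h2
    · exact absurd hj1 (by omega)
    · exact hεR
    · exact hηR
  · rw [Subgroup.closure_le]
    rintro x ⟨y, hy, rfl⟩
    apply Subgroup.subset_closure
    rcases y with ⟨i, _ | _⟩ | j
    · exact Or.inl ⟨i, (hml _).mp hy, Or.inl (ha i)⟩
    · exact Or.inl ⟨i, (hml _).mp hy, Or.inr (hb i)⟩
    · have hj : (j : ℕ) + 1 = s₁ := (hmr _).mp hy
      have : j = ⟨s₁ - 1, by omega⟩ := Fin.ext (by simp only; omega)
      rw [this, hA (by omega)]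
      exact Or.inr (Or.inr (Or.inl rfl))

end Literature.GroupTheory.CombinatorialGroupTheory.PuncturedSurfaceGroup

namespace Literature.AnabelianGeometry.SemiGraphs

namespace PSCDatum

open scoped Pointwise
open Literature.GroupTheory.CombinatorialGroupTheory
open Literature.GroupTheory.CombinatorialGroupTheory.PuncturedSurfaceGroup (a b c
  exists_freeGroupBasis_nodeLoop closure_firstSubsurface_eq_nodeLoopBasis closure_secondSubsurface_eq_nodeLoopBasis
  closure_chainMid_unmarkedMid_eq)
open Literature.GroupTheory.CombinatorialGroupTheory.FreeFactorFibredTwist (lift_apply_basis)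
open SemiGraphOfAnabelioids (IsProSigmaCompletion)
open SemiGraphOfAnabelioids.IsProSigmaCompletion (freeFactor_exists_open_separating_sameVertex
  freeFactor_exists_open_separating_crossVertex)

variable {P : Type} [Group P] [TopologicalSpace P] [IsTopologicalGroup P]
variable [CompactSpace P] [TotallyDisconnectedSpace P] {Sigma : Set ℕ} {g r : ℕ}

/-- **Row P12-L01-V / F-2826 (`VerticialSeparatingCoverings`, `V' := V`) at EVERY three-component chain datum
whose MIDDLE component is UNMARKED** (`s₁ = s₂`, `1 ≤ s₁ < r`, `1 ≤ g₀ < g₁ < g`).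
[cite: MochizukiCombGC2007, Prop 1.2 proof p.9] -/
theorem verticialSeparatingCoverings_of_threeChain_unmarkedMid (hne : Sigma.Nonempty)
    (hprime : ∀ p ∈ Sigma, p.Prime) (ι : PuncturedSurfaceGroup g r →* P)
    (hι : IsProSigmaCompletion Sigma ι) (G : PSCDatum P) {g₀ g₁ s₁ s₂ : ℕ} (hg₀ : 1 ≤ g₀) (hg : g₀ < g₁)
    (hg₁ : g₁ < g) (hs₁ : 1 ≤ s₁) (hs₁r : s₁ < r) (hs₂ : s₂ = s₁)
    (v₀ vm v₁ : G.graph.V) (hV : ∀ w, w = v₀ ∨ w = vm ∨ w = v₁) (εA η : PuncturedSurfaceGroup g r)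
    (hεA : εA = ((List.finRange r).map fun j : Fin r =>
          if s₂ ≤ (j : ℕ) then PuncturedSurfaceGroup.c (g := g) j else 1).prod *
        ((List.finRange g).map fun i : Fin g => if (i : ℕ) < g₀ then
          PuncturedSurfaceGroup.a (r := r) i * PuncturedSurfaceGroup.b i *
            (PuncturedSurfaceGroup.a i)⁻¹ * (PuncturedSurfaceGroup.b i)⁻¹ else 1).prod)
    (hη : η = ((List.finRange r).map fun j : Fin r =>
          if s₁ ≤ (j : ℕ) then PuncturedSurfaceGroup.c (g := g) j else 1).prod *
        ((List.finRange g).map fun i : Fin g => if (i : ℕ) < g₁ then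
          PuncturedSurfaceGroup.a (r := r) i * PuncturedSurfaceGroup.b i *
            (PuncturedSurfaceGroup.a i)⁻¹ * (PuncturedSurfaceGroup.b i)⁻¹ else 1).prod)
    (hV₀ : G.vertGp v₀ = ((Subgroup.closure {x : PuncturedSurfaceGroup g r |
        (∃ i : Fin g, (i : ℕ) < g₀ ∧ (x = PuncturedSurfaceGroup.a i ∨ x = PuncturedSurfaceGroup.b i)) ∨
        ∃ j : Fin r, s₂ ≤ (j : ℕ) ∧ x = PuncturedSurfaceGroup.c j}).map ι).topologicalClosure)
    (hVm : G.vertGp vm = ((Subgroup.closure {x : PuncturedSurfaceGroup g r |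
        (∃ i : Fin g, (g₀ ≤ (i : ℕ) ∧ (i : ℕ) < g₁) ∧
          (x = PuncturedSurfaceGroup.a i ∨ x = PuncturedSurfaceGroup.b i)) ∨
        (∃ j : Fin r, (s₁ ≤ (j : ℕ) ∧ (j : ℕ) < s₂) ∧ x = PuncturedSurfaceGroup.c j) ∨
        x = εA ∨ x = η}).map ι).topologicalClosure)
    (hV₁ : G.vertGp v₁ = ((Subgroup.closure {x : PuncturedSurfaceGroup g r |
        (∃ i : Fin g, g₁ ≤ (i : ℕ) ∧ (x = PuncturedSurfaceGroup.a i ∨ x = PuncturedSurfaceGroup.b i)) ∨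
        (∃ j : Fin r, (j : ℕ) < s₁ ∧ x = PuncturedSurfaceGroup.c j) ∨ x = η}).map ι).topologicalClosure) :
    G.VerticialSeparatingCoverings := by
  classical
  subst s₂
  obtain ⟨r', rfl⟩ : ∃ r', r = r' + 1 := ⟨r - 1, by omega⟩
  obtain ⟨ℓ, hℓS⟩ := hne
  have hℓ : ℓ.Prime := hprime ℓ hℓS
  have hSig : ∃ ℓ ∈ Sigma, ℓ.Prime := ⟨ℓ, hℓS, hℓ⟩
  -- the two node-loop bases
  obtain ⟨bA, ha, hb, hc, hkA⟩ := exists_freeGroupBasis_nodeLoop g r' g₀ s₁ hs₁ (by omega) εA hεA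
  obtain ⟨bB, ha', hb', hc', hkB⟩ := exists_freeGroupBasis_nodeLoop g r' g₁ s₁ hs₁ (by omega) η hη
  have hkA' : ∀ h : s₁ - 1 < r', bA (Sum.inr ⟨s₁ - 1, h⟩) = εA := fun _ => hkA
  have hkB' : ∀ h : s₁ - 1 < r', bB (Sum.inr ⟨s₁ - 1, h⟩) = η := fun _ => hkB
  have hslot : s₁ - 1 < r' := by omega
  -- the index sets
  obtain ⟨S₀, hS₀⟩ : ∃ S : Set ((Fin g × Bool) ⊕ Fin r'),
      S = {x | Sum.elim (fun p : Fin g × Bool => (p.1 : ℕ) < g₀) (fun j : Fin r' => s₁ ≤ (j : ℕ) + 1) x} :=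
    ⟨_, rfl⟩
  obtain ⟨Sm, hSm⟩ : ∃ S : Set ((Fin g × Bool) ⊕ Fin r'),
      S = {x | Sum.elim (fun p : Fin g × Bool => g₀ ≤ (p.1 : ℕ) ∧ (p.1 : ℕ) < g₁)
        (fun j : Fin r' => (j : ℕ) + 1 = s₁) x} := ⟨_, rfl⟩
  obtain ⟨T₁, hT₁⟩ : ∃ S : Set ((Fin g × Bool) ⊕ Fin r'),
      S = {x | Sum.elim (fun p : Fin g × Bool => g₁ ≤ (p.1 : ℕ)) (fun j : Fin r' => (j : ℕ) + 1 ≤ s₁) x} :=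
    ⟨_, rfl⟩
  have h0l : ∀ p : Fin g × Bool, (Sum.inl p : (Fin g × Bool) ⊕ Fin r') ∈ S₀ ↔ (p.1 : ℕ) < g₀ :=
    fun _ => by rw [hS₀]; exact Iff.rfl
  have hml : ∀ p : Fin g × Bool, (Sum.inl p : (Fin g × Bool) ⊕ Fin r') ∈ Sm ↔
      g₀ ≤ (p.1 : ℕ) ∧ (p.1 : ℕ) < g₁ := fun _ => by rw [hSm]; exact Iff.rfl
  have h1l : ∀ p : Fin g × Bool, (Sum.inl p : (Fin g × Bool) ⊕ Fin r') ∈ T₁ ↔ g₁ ≤ (p.1 : ℕ) :=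
    fun _ => by rw [hT₁]; exact Iff.rfl
  have h1r : ∀ j : Fin r', (Sum.inr j : (Fin g × Bool) ⊕ Fin r') ∈ T₁ ↔ (j : ℕ) + 1 ≤ s₁ :=
    fun _ => by rw [hT₁]; exact Iff.rfl
  -- the three vertex groups
  have hA₀ : G.vertGp v₀ = ((Subgroup.closure (bA '' S₀)).map ι).topologicalClosure := by
    rw [hV₀, hS₀, closure_firstSubsurface_eq_nodeLoopBasis hεA ha hb hc hkA' hs₁ (by omega)]
  have hAm : G.vertGp vm = ((Subgroup.closure (bA '' Sm)).map ι).topologicalClosure := by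
    rw [hVm, hSm, closure_chainMid_unmarkedMid_eq hεA hη ha hb hkA' hg.le hs₁ (by omega)]
  have hA₁ : G.vertGp v₁ = ((Subgroup.closure (bB '' T₁)).map ι).topologicalClosure := by
    rw [hV₁, hT₁, closure_secondSubsurface_eq_nodeLoopBasis hη ha' hb' hc' hkB' hs₁ (by omega)]
  -- membership helpers and the handle-letter witnesses `a_0`, `a_{g₀}`, `a_{g₁}`
  have hclA : ∀ (S : Set ((Fin g × Bool) ⊕ Fin r')) (y), y ∈ S →
      ι (bA y) ∈ ((Subgroup.closure (bA '' S)).map ι).topologicalClosure := fun S y hy =>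
    Subgroup.le_topologicalClosure _ (Subgroup.mem_map_of_mem ι (Subgroup.subset_closure ⟨y, hy, rfl⟩))
  have hclB : ∀ (S : Set ((Fin g × Bool) ⊕ Fin r')) (y), y ∈ S →
      ι (bB y) ∈ ((Subgroup.closure (bB '' S)).map ι).topologicalClosure := fun S y hy =>
    Subgroup.le_topologicalClosure _ (Subgroup.mem_map_of_mem ι (Subgroup.subset_closure ⟨y, hy, rfl⟩))
  have hAB : ∀ i : Fin g, bA (Sum.inl (i, false)) = bB (Sum.inl (i, false)) := fun i => by rw [ha, ha']
  have hμ0S : (Sum.inl (⟨0, by omega⟩, false) : (Fin g × Bool) ⊕ Fin r') ∈ S₀ := (h0l _).mpr (by simp only; omega)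
  have hμ0m : (Sum.inl (⟨0, by omega⟩, false) : (Fin g × Bool) ⊕ Fin r') ∉ Sm := fun h => by
    have := (hml _).mp h; simp only at this; omega
  have hμ0T : (Sum.inl (⟨0, by omega⟩, false) : (Fin g × Bool) ⊕ Fin r') ∉ T₁ := fun h => by
    have := (h1l _).mp h; simp only at this; omega
  have hμmS : (Sum.inl (⟨g₀, by omega⟩, false) : (Fin g × Bool) ⊕ Fin r') ∉ S₀ := fun h => by
    have := (h0l _).mp h; simp only at this; omega
  have hμmm : (Sum.inl (⟨g₀, by omega⟩, false) : (Fin g × Bool) ⊕ Fin r') ∈ Sm :=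
    (hml _).mpr (by simp only; omega)
  have hμmT : (Sum.inl (⟨g₀, by omega⟩, false) : (Fin g × Bool) ⊕ Fin r') ∉ T₁ := fun h => by
    have := (h1l _).mp h; simp only at this; omega
  have hμ1S : (Sum.inl (⟨g₁, by omega⟩, false) : (Fin g × Bool) ⊕ Fin r') ∉ S₀ := fun h => by
    have := (h0l _).mp h; simp only at this; omega
  have hμ1m : (Sum.inl (⟨g₁, by omega⟩, false) : (Fin g × Bool) ⊕ Fin r') ∉ Sm := fun h => by
    have := (hml _).mp h; simp only at this; omega
  have hμ1T : (Sum.inl (⟨g₁, by omega⟩, false) : (Fin g × Bool) ⊕ Fin r') ∈ T₁ :=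
    (h1l _).mpr (by simp only; exact le_rfl)
  have hτT : (Sum.inr ⟨s₁ - 1, hslot⟩ : (Fin g × Bool) ⊕ Fin r') ∈ T₁ := (h1r _).mpr (by simp only; omega)
  -- the free-factor projections
  let ρ₀ : PuncturedSurfaceGroup g (r' + 1) →* PuncturedSurfaceGroup g (r' + 1) :=
    bA.lift fun y => if y ∈ S₀ then 1 else bA y
  have hρ₀ : ∀ y, ρ₀ (bA y) = if y ∈ S₀ then 1 else bA y := fun y => lift_apply_basis bA _ y
  let ρm : PuncturedSurfaceGroup g (r' + 1) →* PuncturedSurfaceGroup g (r' + 1) :=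
    bA.lift fun y => if y ∈ Sm then 1 else bA y
  have hρm : ∀ y, ρm (bA y) = if y ∈ Sm then 1 else bA y := fun y => lift_apply_basis bA _ y
  let ρ₁ : PuncturedSurfaceGroup g (r' + 1) →* PuncturedSurfaceGroup g (r' + 1) :=
    bB.lift fun y => if y ∈ T₁ then 1 else bB y
  have hρ₁ : ∀ y, ρ₁ (bB y) = if y ∈ T₁ then 1 else bB y := fun y => lift_apply_basis bB _ y
  refine G.verticialSeparatingCoverings_of_sameVertex_of_crossVertex (fun V hVn hVo v γ₁ γ₂ hne => ?_)
    (fun V hVn hVo w₁ w₂ γ₁ γ₂ h12 => ?_)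
  · -- same vertex: free-factor fibred twists
    haveI := hVn
    rcases hV v with rfl | rfl | rfl
    · exact freeFactor_exists_open_separating_sameVertex hι bA S₀ ⟨_, hμ0S⟩ hℓ hℓS (G.vertGp v) hA₀ V hVo γ₁ γ₂
        hne
    · exact freeFactor_exists_open_separating_sameVertex hι bA Sm ⟨_, hμmm⟩ hℓ hℓS (G.vertGp v) hAm V hVo γ₁ γ₂
        hne
    · exact freeFactor_exists_open_separating_sameVertex hι bB T₁ ⟨_, hτT⟩ hℓ hℓS (G.vertGp v) hA₁ V hVo γ₁ γ₂
        hne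
  · -- different vertices: free-factor projections with handle-letter witnesses
    haveI := hVn
    by_cases h2 : w₂ = v₀
    · rw [h2] at h12 ⊢
      rcases hV w₁ with h1 | h1 | h1
      · exact absurd h1 h12
      · refine freeFactor_exists_open_separating_crossVertex hι hSig bA S₀ ρ₀ hρ₀ (G.vertGp v₀) hA₀ (G.vertGp w₁)
          _ (by rw [h1, hAm]; exact hclA Sm _ hμmm) ?_ V hVo γ₁ γ₂
        rw [hρ₀, if_neg hμmS]; exact FreeGroupBasis.apply_ne_one _ _
      · refine freeFactor_exists_open_separating_crossVertex hι hSig bA S₀ ρ₀ hρ₀ (G.vertGp v₀) hA₀ (G.vertGp w₁)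
          (bA (Sum.inl (⟨g₁, by omega⟩, false))) (by rw [h1, hA₁, hAB]; exact hclB T₁ _ hμ1T) ?_ V hVo γ₁ γ₂
        rw [hρ₀, if_neg hμ1S]; exact FreeGroupBasis.apply_ne_one _ _
    · by_cases h2' : w₂ = vm
      · rw [h2'] at h12 h2 ⊢
        rcases hV w₁ with h1 | h1 | h1
        · refine freeFactor_exists_open_separating_crossVertex hι hSig bA Sm ρm hρm (G.vertGp vm) hAm (G.vertGp w₁)
            _ (by rw [h1, hA₀]; exact hclA S₀ _ hμ0S) ?_ V hVo γ₁ γ₂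
          rw [hρm, if_neg hμ0m]; exact FreeGroupBasis.apply_ne_one _ _
        · exact absurd h1 h12
        · refine freeFactor_exists_open_separating_crossVertex hι hSig bA Sm ρm hρm (G.vertGp vm) hAm (G.vertGp w₁)
            (bA (Sum.inl (⟨g₁, by omega⟩, false))) (by rw [h1, hA₁, hAB]; exact hclB T₁ _ hμ1T) ?_ V hVo γ₁ γ₂
          rw [hρm, if_neg hμ1m]; exact FreeGroupBasis.apply_ne_one _ _
      · have hw₂ : w₂ = v₁ := by
          rcases hV w₂ with h | h | h
          · exact absurd h h2
          · exact absurd h h2'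
          · exact h
        rw [hw₂] at h12 ⊢
        rcases hV w₁ with h1 | h1 | h1
        · refine freeFactor_exists_open_separating_crossVertex hι hSig bB T₁ ρ₁ hρ₁ (G.vertGp v₁) hA₁ (G.vertGp w₁)
            (bB (Sum.inl (⟨0, by omega⟩, false))) (by rw [h1, hA₀, ← hAB]; exact hclA S₀ _ hμ0S) ?_ V hVo γ₁ γ₂
          rw [hρ₁, if_neg hμ0T]; exact FreeGroupBasis.apply_ne_one _ _
        · refine freeFactor_exists_open_separating_crossVertex hι hSig bB T₁ ρ₁ hρ₁ (G.vertGp v₁) hA₁ (G.vertGp w₁)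
            (bB (Sum.inl (⟨g₀, by omega⟩, false))) (by rw [h1, hAm, ← hAB]; exact hclA Sm _ hμmm) ?_ V hVo γ₁ γ₂
          rw [hρ₁, if_neg hμmT]; exact FreeGroupBasis.apply_ne_one _ _
        · exact absurd h1 h12

end PSCDatum

end Literature.AnabelianGeometry.SemiGraphs

end
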